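import Literature.Topology.FourManifolds.MMSWPictureModelPieces
import HarnessLib

/-!
# The model identification `M_k ∖ K → Y`: definition by zones and smoothness

Topic `Literature/Topology/FourManifolds`; part of the proof of the named fact
`Literature.Topology.FourManifolds.pictureSurgeryPresentation` (`MMSWPictureSurgery.lean`; Kirby,
*The Topology of 4-Manifolds*, LNM 1374 (1989), Ch. I §2, Lemma 2.1).  Everything here is proved;
no named fact is introduced.

Given the pieces of a surgery presentation — a map `JA : 𝕊³ → Y` (the link complement into the
surgered manifold, extended anyhow) and maps `JB i : ℝ² × 𝕊¹ → Y` (the glued-in solid tori,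
extended anyhow) — and the reflection flags `fl` of the thin tubes, the identification is defined
in the complex coordinates `(z, w)` of `ℝ⁴` by zones (`modelMap`):

* on the **inner core zones** `zoneA k η j = {½ < |z − c_j| < 27/20, |w| < 1/5, g(z) > 1 − η}`:
  `JB j (bPt j (z, w))`;
* on the **outer core zone** `zoneO k η = {18(k+1) < |z| < 50(k+1), |w| < 1/5, g(z) > 1 − η}`:
  `JA (outS (z, w))`;
* elsewhere: `JA (virtS (z, w))`, the virtual sphere point.

When the pieces glue as in a surgery presentation (`JB j (bPt j p) = JA (virtS p)` for `p` in the
`j`-th core zone with `w ≠ 0`), the last formula holds throughout `{w ≠ 0}`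
(`modelMap_eq_of_ne_zero`), and `modelMap` is smooth on the open set `goodSet`
(`contMDiffOn_modelMap`).

## References

* R. Kirby, *The Topology of 4-Manifolds*, LNM 1374 (1989), Ch. I §2. [Kirby1989]
-/

open scoped Manifold ContDiff Topology Real ComplexConjugate
open Function Set Metric

noncomputable section

namespace Literature.Topology.FourManifolds

/-- Local notation: `𝔼 n` is the model Euclidean space `EuclideanSpace ℝ (Fin n)`. -/
local notation "𝔼 " n:arg => EuclideanSpace ℝ (Fin n)
/-- Local notation: `𝕊 n` is the unit sphere of `EuclideanSpace ℝ (Fin (n + 1))`. -/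
local notation "𝕊 " n:arg => (Metric.sphere (0 : EuclideanSpace ℝ (Fin (n + 1))) 1)

namespace MMSW

variable {k : ℕ} {η : ℝ}

/-! ## The zones -/

/-- **The inner core zone** about the `j`-th core. [folklore] -/
def zoneA (k : ℕ) (η : ℝ) (j : Fin k) : Set (ℂ × ℂ) :=
  {p | p.1 ∈ annulus (holeCentre k j) (1 / 2) (27 / 20) ∧ ‖p.2‖ < 1 / 5 ∧ 1 - η < planarPot k p.1}

/-- **The outer core zone.** [folklore] -/
def zoneO (k : ℕ) (η : ℝ) : Set (ℂ × ℂ) :=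
  {p | 18 * ((k : ℝ) + 1) < ‖p.1‖ ∧ ‖p.1‖ < 50 * ((k : ℝ) + 1) ∧ ‖p.2‖ < 1 / 5 ∧
    1 - η < planarPot k p.1}

variable {p : ℂ × ℂ}

/-- Points of the `j`-th inner core zone are off the poles. [folklore] -/
theorem ne_holeCentre_of_mem_zoneA {j : Fin k} (hp : p ∈ zoneA k η j) (i : Fin k) :
    p.1 ≠ holeCentre k i :=
  ne_holeCentre_of_mem_annulus hp.1 i

/-- Points of the outer core zone are off the poles. [folklore] -/
theorem ne_holeCentre_of_mem_zoneO (hp : p ∈ zoneO k η) (i : Fin k) : p.1 ≠ holeCentre k i := by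
  intro h
  have h1 := norm_holeCentre_le (r := k) i
  have h2 := hp.1
  rw [h] at h2
  have hk : (0 : ℝ) ≤ k := Nat.cast_nonneg k
  linarith

/-- Points of the outer core zone are off the focus. [folklore] -/
theorem coLat_ne_zero_of_mem_zoneO (hp : p ∈ zoneO k η) : coLat k p.1 ≠ 0 :=
  coLat_ne_zero_of_lt_norm (by linarith [hp.1]) (by unfold drawRadius; linarith [hp.2.1])

/-- The potential is continuous at points off the poles, as a function of `(z, w)`. [folklore] -/
theorem continuousAt_planarPot_fst (h : ∀ i : Fin k, p.1 ≠ holeCentre k i) :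
    ContinuousAt (fun q : ℂ × ℂ ↦ planarPot k q.1) p :=
  ((contDiffAt_planarPot (n := ∞) h).continuousAt).comp continuousAt_fst

/-- The inner core zones are open. [folklore] -/
theorem isOpen_zoneA (j : Fin k) : IsOpen (zoneA k η j) := by
  rw [isOpen_iff_mem_nhds]
  intro p hp
  have h1 : {q : ℂ × ℂ | q.1 ∈ annulus (holeCentre k j) (1 / 2) (27 / 20)} ∈ 𝓝 p :=
    ((isOpen_annulus _ _ _).preimage continuous_fst).mem_nhds hp.1
  have h2 : {q : ℂ × ℂ | ‖q.2‖ < 1 / 5} ∈ 𝓝 p :=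
    (isOpen_lt (continuous_norm.comp continuous_snd) continuous_const).mem_nhds hp.2.1
  have h3 : {q : ℂ × ℂ | 1 - η < planarPot k q.1} ∈ 𝓝 p :=
    (continuousAt_planarPot_fst (ne_holeCentre_of_mem_zoneA hp)).preimage_mem_nhds
      (Ioi_mem_nhds hp.2.2)
  filter_upwards [h1, h2, h3] with q hq1 hq2 hq3
  exact ⟨hq1, hq2, hq3⟩

/-- The outer core zone is open. [folklore] -/
theorem isOpen_zoneO : IsOpen (zoneO k η) := by
  rw [isOpen_iff_mem_nhds]
  intro p hp
  have hn : Continuous fun q : ℂ × ℂ ↦ ‖q.1‖ := continuous_norm.comp continuous_fst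
  have h1 : {q : ℂ × ℂ | 18 * ((k : ℝ) + 1) < ‖q.1‖} ∈ 𝓝 p :=
    (isOpen_lt continuous_const hn).mem_nhds hp.1
  have h2 : {q : ℂ × ℂ | ‖q.1‖ < 50 * ((k : ℝ) + 1)} ∈ 𝓝 p :=
    (isOpen_lt hn continuous_const).mem_nhds hp.2.1
  have h3 : {q : ℂ × ℂ | ‖q.2‖ < 1 / 5} ∈ 𝓝 p :=
    (isOpen_lt (continuous_norm.comp continuous_snd) continuous_const).mem_nhds hp.2.2.1
  have h4 : {q : ℂ × ℂ | 1 - η < planarPot k q.1} ∈ 𝓝 p :=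
    (continuousAt_planarPot_fst (ne_holeCentre_of_mem_zoneO hp)).preimage_mem_nhds
      (Ioi_mem_nhds hp.2.2.2)
  filter_upwards [h1, h2, h3, h4] with q hq1 hq2 hq3 hq4
  exact ⟨hq1, hq2, hq3, hq4⟩

/-- The inner core zones are pairwise disjoint: membership determines the hole. [folklore] -/
theorem zoneA_unique {i j : Fin k} (hi : p ∈ zoneA k η i) (hj : p ∈ zoneA k η j) : i = j :=
  eq_of_norm_sub_holeCentre_lt (by linarith [hi.1.2]) (by linarith [hj.1.2])

/-- The inner core zones miss the outer core zone. [folklore] -/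
theorem not_mem_zoneO_of_mem_zoneA {j : Fin k} (hj : p ∈ zoneA k η j) : p ∉ zoneO k η := by
  intro ho
  have h1 : ‖p.1‖ ≤ ‖p.1 - holeCentre k j‖ + ‖holeCentre k j‖ := norm_le_norm_sub_add _ _
  have h2 := norm_holeCentre_le (r := k) j
  have hk : (0 : ℝ) ≤ k := Nat.cast_nonneg k
  linarith [hj.1.2, ho.1]

/-! ## The model map -/

section ModelMap

variable {Y : Type*}

open Classical in
/-- **The model identification** `M_k ∖ K → Y`, defined by zones (see the module docstring).
[folklore] -/
def modelMap (k : ℕ) (η : ℝ) (JA : (𝕊 3) → Y) (JB : Fin (k + 1) → (𝔼 2) × (𝕊 1) → Y)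
    (fl : Fin k → Bool) (p : ℂ × ℂ) : Y :=
  if h : ∃ j, p ∈ zoneA k η j then JB (Fin.castSucc h.choose) (bPt k fl h.choose p)
  else if p ∈ zoneO k η then JA (outS k p) else JA (virtS k η p)

variable {JA : (𝕊 3) → Y} {JB : Fin (k + 1) → (𝔼 2) × (𝕊 1) → Y} {fl : Fin k → Bool}

/-- On the `j`-th inner core zone. [folklore] -/
theorem modelMap_of_mem_zoneA {j : Fin k} (hj : p ∈ zoneA k η j) :
    modelMap k η JA JB fl p = JB (Fin.castSucc j) (bPt k fl j p) := by
  classical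
  have h : ∃ j, p ∈ zoneA k η j := ⟨j, hj⟩
  rw [modelMap, dif_pos h, zoneA_unique h.choose_spec hj]

/-- On the outer core zone. [folklore] -/
theorem modelMap_of_mem_zoneO (ho : p ∈ zoneO k η) : modelMap k η JA JB fl p = JA (outS k p) := by
  classical
  have h : ¬∃ j, p ∈ zoneA k η j := fun ⟨j, hj⟩ ↦ not_mem_zoneO_of_mem_zoneA hj ho
  rw [modelMap, dif_neg h, if_pos ho]

/-- Off the core zones. [folklore] -/
theorem modelMap_of_not_mem (ha : ∀ j, p ∉ zoneA k η j) (ho : p ∉ zoneO k η) :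
    modelMap k η JA JB fl p = JA (virtS k η p) := by
  classical
  have h : ¬∃ j, p ∈ zoneA k η j := fun ⟨j, hj⟩ ↦ ha j hj
  rw [modelMap, dif_neg h, if_neg ho]

/-- **The virtual-point formula holds throughout `{w ≠ 0}`** as soon as the pieces glue on the
inner core zones (`η > 0`). [folklore] -/
theorem modelMap_eq_of_ne_zero (hη : 0 < η)
    (hglue : ∀ (j : Fin k) (q : ℂ × ℂ), q ∈ zoneA k η j → q.2 ≠ 0 →
      JB (Fin.castSucc j) (bPt k fl j q) = JA (virtS k η q))
    (hw : p.2 ≠ 0) : modelMap k η JA JB fl p = JA (virtS k η p) := by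
  by_cases ha : ∃ j, p ∈ zoneA k η j
  · obtain ⟨j, hj⟩ := ha
    rw [modelMap_of_mem_zoneA hj, hglue j p hj hw]
  · push Not at ha
    by_cases ho : p ∈ zoneO k η
    · rw [modelMap_of_mem_zoneO ho, ← virtS_eq_outS hη ho.1.le
        (by unfold drawRadius; linarith [ho.2.1]) ho.2.2.2.le hw]
    · exact modelMap_of_not_mem ha ho

end ModelMap

/-! ## Smoothness -/

section Smooth

variable {Y : Type*} [TopologicalSpace Y] [ChartedSpace (𝔼 3) Y]
variable {JA : (𝕊 3) → Y} {JB : Fin (k + 1) → (𝔼 2) × (𝕊 1) → Y} {fl : Fin k → Bool}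
  {LC : Set (𝕊 3)}

/-- **The general zone**: `w ≠ 0`, `z` off the poles with `|z| < 50(k+1)`, and the virtual point in
the prescribed open set `LC` (the link complement). [folklore] -/
def zoneG (k : ℕ) (η : ℝ) (LC : Set (𝕊 3)) : Set (ℂ × ℂ) :=
  {p | p.2 ≠ 0 ∧ (∀ i : Fin k, p.1 ≠ holeCentre k i) ∧ ‖p.1‖ < 50 * ((k : ℝ) + 1) ∧
    virtS k η p ∈ LC}

/-- The general zone is open (for `LC` open). [folklore] -/
theorem isOpen_zoneG (hLC : IsOpen LC) : IsOpen (zoneG k η LC) := by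
  have hU : IsOpen {p : ℂ × ℂ | p.2 ≠ 0 ∧ (∀ i : Fin k, p.1 ≠ holeCentre k i) ∧
      ‖p.1‖ < 50 * ((k : ℝ) + 1)} := by
    have h1 : IsOpen {p : ℂ × ℂ | p.2 ≠ 0} := isOpen_ne.preimage continuous_snd
    have h2 : IsOpen {p : ℂ × ℂ | ∀ i : Fin k, p.1 ≠ holeCentre k i} := by
      have : {p : ℂ × ℂ | ∀ i : Fin k, p.1 ≠ holeCentre k i} = ⋂ i : Fin k, {p | p.1 ≠ holeCentre k i} := by
        ext p; simp
      rw [this]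
      exact isOpen_iInter_of_finite fun i ↦ isOpen_ne.preimage continuous_fst
    have h3 : IsOpen {p : ℂ × ℂ | ‖p.1‖ < 50 * ((k : ℝ) + 1)} :=
      isOpen_lt (continuous_norm.comp continuous_fst) continuous_const
    exact h1.inter (h2.inter h3)
  have hc : ContinuousOn (virtS k η) {p : ℂ × ℂ | p.2 ≠ 0 ∧ (∀ i : Fin k, p.1 ≠ holeCentre k i) ∧
      ‖p.1‖ < 50 * ((k : ℝ) + 1)} := fun p hp ↦
    (contMDiffAt_virtS hp.1 hp.2.1 hp.2.2).continuousAt.continuousWithinAt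
  have := hc.isOpen_inter_preimage hU hLC
  convert this using 1
  ext p
  simp only [zoneG, mem_setOf_eq, mem_inter_iff, mem_preimage]
  tauto

/-- **The good set** on which the model map is smooth: the core zones and the general zone.
[folklore] -/
def goodSet (k : ℕ) (η : ℝ) (LC : Set (𝕊 3)) : Set (ℂ × ℂ) :=
  ((⋃ j, zoneA k η j) ∪ zoneO k η) ∪ zoneG k η LC

/-- The good set is open. [folklore] -/
theorem isOpen_goodSet (hLC : IsOpen LC) : IsOpen (goodSet k η LC) :=
  ((isOpen_iUnion fun j ↦ isOpen_zoneA j).union isOpen_zoneO).union (isOpen_zoneG hLC)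

/-- **Smoothness of the model map** on the good set, given: `JA` smooth on the open set `LC`,
each `JB i` smooth on the open solid torus `{|q.1| < 1}`, the pieces glue on the inner core zones,
and the outer core points of the outer core zone lie in `LC`. [folklore] -/
theorem contMDiffOn_modelMap (hη : 0 < η) (hLC : IsOpen LC)
    (hJA : ContMDiffOn (𝓡 3) (𝓡 3) ∞ JA LC)
    (hJB : ∀ i, ContMDiffOn (𝓘(ℝ, 𝔼 2).prod (𝓡 1)) (𝓡 3) ∞ (JB i) {q | ‖q.1‖ < 1})
    (hglue : ∀ (j : Fin k) (q : ℂ × ℂ), q ∈ zoneA k η j → q.2 ≠ 0 →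
      JB (Fin.castSucc j) (bPt k fl j q) = JA (virtS k η q))
    (hO : ∀ q ∈ zoneO k η, outS k q ∈ LC) :
    ContMDiffOn 𝓘(ℝ, ℂ × ℂ) (𝓡 3) ∞ (modelMap k η JA JB fl) (goodSet k η LC) := by
  have hB : IsOpen {q : (𝔼 2) × (𝕊 1) | ‖q.1‖ < 1} :=
    isOpen_lt (continuous_norm.comp continuous_fst) continuous_const
  intro p hp
  refine ContMDiffAt.contMDiffWithinAt ?_
  rcases hp with (hp | hp) | hp
  · -- an inner core zone
    obtain ⟨j, hj⟩ := mem_iUnion.1 hp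
    have hev : modelMap k η JA JB fl =ᶠ[𝓝 p] fun q ↦ JB (Fin.castSucc j) (bPt k fl j q) := by
      filter_upwards [(isOpen_zoneA j).mem_nhds hj] with q hq
      exact modelMap_of_mem_zoneA hq
    refine ContMDiffAt.congr_of_eventuallyEq ?_ hev
    have hb : bPt k fl j p ∈ {q : (𝔼 2) × (𝕊 1) | ‖q.1‖ < 1} := by
      show ‖(bPt k fl j p).1‖ < 1
      rw [norm_bPt_fst]; linarith [hj.2.1]
    exact ((hJB _).contMDiffAt (hB.mem_nhds hb)).comp p
      (contMDiffAt_bPt fl (ne_holeCentre_of_mem_zoneA hj j))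
  · -- the outer core zone
    have hev : modelMap k η JA JB fl =ᶠ[𝓝 p] fun q ↦ JA (outS k q) := by
      filter_upwards [isOpen_zoneO.mem_nhds hp] with q hq
      exact modelMap_of_mem_zoneO hq
    refine ContMDiffAt.congr_of_eventuallyEq ?_ hev
    exact (hJA.contMDiffAt (hLC.mem_nhds (hO p hp))).comp p
      (contMDiffAt_outS (coLat_ne_zero_of_mem_zoneO hp))
  · -- the general zone
    have hev : modelMap k η JA JB fl =ᶠ[𝓝 p] fun q ↦ JA (virtS k η q) := by
      filter_upwards [(isOpen_zoneG hLC).mem_nhds hp] with q hq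
      exact modelMap_eq_of_ne_zero hη hglue hq.1
    refine ContMDiffAt.congr_of_eventuallyEq ?_ hev
    exact (hJA.contMDiffAt (hLC.mem_nhds hp.2.2.2)).comp p
      (contMDiffAt_virtS hp.1 hp.2.1 hp.2.2.1)

end Smooth

end MMSW

end Literature.Topology.FourManifolds
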